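import Literature.Geometry.DiscreteGeometry.KissingPatterns
import Literature.Probability.Process.PointStationaryLaw
import Literature.MathematicalPhysics.StatisticalMechanics.RootEnergy
import Literature.MathematicalPhysics.StatisticalMechanics.Crystallization
import Literature.MathematicalPhysics.StatisticalMechanics.MuGroundStateConfiguration
import Literature.MathematicalPhysics.StatisticalMechanics.BarlowStacking
import Literature.MathematicalPhysics.StatisticalMechanics.HaggStacking
import Summits.AtomisticToContinuum.Crystallization.Theorems.RepetitiveNetworkReductionRecurrentMemberDefs

/-!
# `CollaredCoreLawGap.stub_coreChargeGS` — the Palm bookkeeping stub, BY NAME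

Registered stub `stub_coreChargeGS` of the crux `GrainCoreNetworkSplit.CollaredCoreLawGap` (`stmt-AtomisticToContinuum-27072`; routes `GrainCoreNetworkSplit`
and `RepetitiveNetworkReduction`, sub-problem `Crystallization` of `AtomisticToContinuum`), skeleton of record v3 (decomp-a2c
lens-2 g18, «door re-cut»).  Statement (verbatim the registered text): a point-stationary probability law of rooted `δ`-hard-core
configurations, a.s. texture-approachable (`Appr`), a.s. Nash, a.s. NOT a periodic translate, a.s. an e⋆-`μ`-ground-state
configuration (name-free `MuG` clause), giving POSITIVE mass to the collared-core event, with mean root energy `≤ e⋆`, CHARGES ONE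
rooted `δ`-separated point set `S ∋ 0` carrying the set-level versions of these properties, the collared-core event, and
`IsMuGSC lennardJones e⋆ S`.

Proof («a positive-mass event meets almost-sure events», `MeasureTheory.frequently_ae_mem_iff` +
`Filter.Frequently.and_eventually`, then the counting-measure dictionary `count|S {q} ≠ 0 ↔ q ∈ S`); point-stationarity and
the mean hypothesis are unused (TRUE-type bookkeeping).  All `[folklore]`.
-/

namespace Summit.AtomisticToContinuum.Crystallization.Theorems.GrainCoreNetworkSplitCoreCharge

open MeasureTheory Literature.Probability.Process Literature.MathematicalPhysics.StatisticalMechanics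

/-- The atoms of `count|S` are the points of `S`. [folklore] -/
theorem setOf_count_restrict_ne_zero (S : Set (EuclideanSpace ℝ (Fin 3))) :
    {p : EuclideanSpace ℝ (Fin 3) | (Measure.count : Measure (EuclideanSpace ℝ (Fin 3))).restrict S {p} ≠ 0} = S :=
  Set.ext fun p => count_restrict_singleton_ne_zero_iff S p

/-- **Registered stub `stub_coreChargeGS` of `CollaredCoreLawGap`, verbatim text.** [folklore] -/
theorem stub_coreChargeGS : ∀ δ : ℝ, 0 < δ → ∀ P : MeasureTheory.Measure (MeasureTheory.Measure (EuclideanSpace ℝ (Fin 3))), let Gy : ℝ → (N : ℕ) → (Fin N → EuclideanSpace ℝ (Fin 3)) → Fin N → Prop := fun η N y j => let d : ℝ := sInf ((fun z => dist z (y (j : Fin N))) '' (Set.range (y) \ {(y (j : Fin N))})); let T : Set (EuclideanSpace ℝ (Fin 3)) := {z : EuclideanSpace ℝ (Fin 3) | z ∈ Set.range (y) ∧ z ≠ (y (j : Fin N)) ∧ dist z (y (j : Fin N)) < 13 / 10 * d}; ∃ A : EuclideanSpace ℝ (Fin 3) →ₗᵢ[ℝ] EuclideanSpace ℝ (Fin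 3), (∃ e : ↥T ≃ ↥Literature.Geometry.DiscreteGeometry.fccKissingPattern, ∀ t : ↥T, dist (d⁻¹ • ((t : EuclideanSpace ℝ (Fin 3)) - (y (j : Fin N)))) (A ((e t : ↥Literature.Geometry.DiscreteGeometry.fccKissingPattern) : EuclideanSpace ℝ (Fin 3))) ≤ η) ∨ (∃ e : ↥T ≃ ↥Literature.Geometry.DiscreteGeometry.hcpKissingPattern, ∀ t : ↥T, dist (d⁻¹ • ((t : EuclideanSpace ℝ (Fin 3)) - (y (j : Fin N)))) (A ((e t : ↥Literature.Geometry.DiscreteGeometry.hcpKissingPattern) : EuclideanSpace ℝ (Fin 3))) ≤ η); let TexBall : (N : ℕ) → (Fin N → EuclideanSpace ℝ (Fin 3)) → Fin N → ℝ → ℝ → ℝ → ℝ → Prop := fun N y i R R₇ R₈ R₉ => (∀ a b : Fin N, a ≠ b → (7 : ℝ) / 10 ≤ dist (y a) (y b)) ∧ (∀ j : Fin N, dist (y j) (y i) ≤ R → ¬ Gy (1 / 20) N (y) j) ∧ (∀ j : Fin N, dist (y j) (y i) ≤ R → ¬ ((∀ j' : Fin N, dist (y j') (y j) ≤ R₇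 → ¬ Gy (1 / 20) N (y) j') ∧ (∀ z : EuclideanSpace ℝ (Fin 3), dist z (y j) ≤ R₇ → ∃ k : Fin N, dist z (y k) ≤ 1) ∧ (∀ j' : Fin N, dist (y j') (y j) ≤ R₇ → (let d : ℝ := sInf ((fun z => dist z (y j')) '' (Set.range (y) \ {(y j')})); ∀ k : Fin N, y k ≠ y j' → dist (y k) (y j') < 27 / 20 * d → 5 ≤ Nat.card {m : Fin N // y m ≠ y j' ∧ dist (y m) (y j') < 27 / 20 * d ∧ y m ≠ y k ∧ dist (y m) (y k) < 27 / 20 * d})))) ∧ (∀ j : Fin N, dist (y j) (y i) ≤ R → ∃ k : Fin N, dist (y k) (y j) ≤ R₈ ∧ Gy (1 / 8) N (y) k) ∧ (∀ j : Fin N, dist (y j) (y i) ≤ R → ¬ ((∀ j' : Fin N, dist (y j') (y j) ≤ R₉ → ¬ Gy (1 / 20) N (y) j') ∧ (Nat.card {j' : Fin N // dist (y j') (y j) ≤ R₉ ∧ ¬ Gy (1 / 8) N (y) j'} : ℝ) ≤ 1 / 2 * (Nat.card {j' : Fin N // dist (y j') (y j) ≤ R₉} : ℝ) ∧ (∀ j'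 : Fin N, dist (y j') (y j) ≤ R₉ → ¬ Gy (1 / 8) N (y) j' → ¬ (let d : ℝ := sInf ((fun z => dist z (y j')) '' (Set.range (y) \ {(y j')})); ∀ k : Fin N, y k ≠ y j' → dist (y k) (y j') < 27 / 20 * d → 5 ≤ Nat.card {m : Fin N // y m ≠ y j' ∧ dist (y m) (y j') < 27 / 20 * d ∧ y m ≠ y k ∧ dist (y m) (y k) < 27 / 20 * d})))); let Appr : MeasureTheory.Measure (EuclideanSpace ℝ (Fin 3)) → ℝ → ℝ → ℝ → Prop := fun μ R₇ R₈ R₉ => ∀ q : EuclideanSpace ℝ (Fin 3), μ {q} ≠ 0 → ∀ R ε : ℝ, 0 < ε → ∃ (N : ℕ) (y : Fin N → EuclideanSpace ℝ (Fin 3)) (i : Fin N), TexBall N y i R R₇ R₈ R₉ ∧ (∀ p : EuclideanSpace ℝ (Fin 3), μ {p} ≠ 0 → dist p q ≤ R → ∃ k : Fin N, dist (y k - y i) (p - q) ≤ ε) ∧ (∀ k : Fin N, dist (y k) (y i) ≤ R → ∃ p : EuclideanSpace ℝ (Fin 3), μ {p} ≠ 0 ∧ dist (y k - y i) (p - q)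 ≤ ε); let ApprS : Set (EuclideanSpace ℝ (Fin 3)) → ℝ → ℝ → ℝ → Prop := fun S R₇ R₈ R₉ => ∀ q : EuclideanSpace ℝ (Fin 3), q ∈ S → ∀ R ε : ℝ, 0 < ε → ∃ (N : ℕ) (y : Fin N → EuclideanSpace ℝ (Fin 3)) (i : Fin N), TexBall N y i R R₇ R₈ R₉ ∧ (∀ p : EuclideanSpace ℝ (Fin 3), p ∈ S → dist p q ≤ R → ∃ k : Fin N, dist (y k - y i) (p - q) ≤ ε) ∧ (∀ k : Fin N, dist (y k) (y i) ≤ R → ∃ p : EuclideanSpace ℝ (Fin 3), p ∈ S ∧ dist (y k - y i) (p - q) ≤ ε); let NashS : Set (EuclideanSpace ℝ (Fin 3)) → Prop := fun S => ∀ p : EuclideanSpace ℝ (Fin 3), p ∈ S → ∀ y : EuclideanSpace ℝ (Fin 3), (∀ q : EuclideanSpace ℝ (Fin 3), q ∈ S → q ≠ p → y ≠ q) → ∑' q : {q : EuclideanSpace ℝ (Fin 3) // q ∈ S ∧ q ≠ p}, Literature.MathematicalPhysics.StatisticalMechanics.lennardJones (dist p (q : EuclideanSpace ℝ (Fin 3)))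 ≤ ∑' q : {q : EuclideanSpace ℝ (Fin 3) // q ∈ S ∧ q ≠ p}, Literature.MathematicalPhysics.StatisticalMechanics.lennardJones (dist y (q : EuclideanSpace ℝ (Fin 3))); let AtomS : MeasureTheory.Measure (EuclideanSpace ℝ (Fin 3)) → Set (EuclideanSpace ℝ (Fin 3)) := fun μ => {p : EuclideanSpace ℝ (Fin 3) | μ {p} ≠ 0}; let GyS : ℝ → Set (EuclideanSpace ℝ (Fin 3)) → EuclideanSpace ℝ (Fin 3) → Prop := fun η S x => let d : ℝ := sInf ((fun z => dist z x) '' (S \ {x})); let T : Set (EuclideanSpace ℝ (Fin 3)) := {z : EuclideanSpace ℝ (Fin 3) | z ∈ S ∧ z ≠ x ∧ dist z x < 13 / 10 * d}; ∃ A : EuclideanSpace ℝ (Fin 3) →ₗᵢ[ℝ] EuclideanSpace ℝ (Fin 3), (∃ e : ↥T ≃ ↥Literature.Geometry.DiscreteGeometry.fccKissingPattern, ∀ t : ↥T, dist (d⁻¹ • ((t : EuclideanSpace ℝ (Fin 3)) - x)) (A ((e t : ↥Literature.Geometry.DiscreteGeometry.fccKissingPattern) : EuclideanSpace ℝ (Fin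 3))) ≤ η) ∨ (∃ e : ↥T ≃ ↥Literature.Geometry.DiscreteGeometry.hcpKissingPattern, ∀ t : ↥T, dist (d⁻¹ • ((t : EuclideanSpace ℝ (Fin 3)) - x)) (A ((e t : ↥Literature.Geometry.DiscreteGeometry.hcpKissingPattern) : EuclideanSpace ℝ (Fin 3))) ≤ η); let Band : (EuclideanSpace ℝ (Fin 3) →L[ℝ] EuclideanSpace ℝ (Fin 3)) → Prop := fun A => ∀ v : EuclideanSpace ℝ (Fin 3), 9 / 10 * ‖v‖ ≤ ‖A v‖ ∧ ‖A v‖ ≤ 11 / 10 * ‖v‖; let Tmpl : (EuclideanSpace ℝ (Fin 3) →L[ℝ] EuclideanSpace ℝ (Fin 3)) → (ℤ → ℤ) → EuclideanSpace ℝ (Fin 3) → EuclideanSpace ℝ (Fin 3) → Set (EuclideanSpace ℝ (Fin 3)) := fun A s c x => (fun b : EuclideanSpace ℝ (Fin 3) => x + A (b - c)) '' Literature.MathematicalPhysics.StatisticalMechanics.barlowStacking 1 (Real.sqrt (2 / 3)) s; let CollarS : Set (EuclideanSpace ℝ (Fin 3)) → EuclideanSpace ℝ (Fin 3) → Prop :=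 fun S x => ∃ (A : EuclideanSpace ℝ (Fin 3) →L[ℝ] EuclideanSpace ℝ (Fin 3)) (s : ℤ → ℤ) (c : EuclideanSpace ℝ (Fin 3)), Literature.MathematicalPhysics.StatisticalMechanics.IsHaggSeq s ∧ Band A ∧ (∀ y ∈ S, 2 ≤ dist y x → dist y x ≤ 6 → ∃ p ∈ Tmpl A s c x, dist y p ≤ 1 / 50) ∧ (∀ p ∈ Tmpl A s c x, 2 ≤ dist p x → dist p x ≤ 6 → ∃ y ∈ S, dist y p ≤ 1 / 50); MeasureTheory.IsProbabilityMeasure P → (∀ᵐ μ ∂P, Literature.Probability.Process.IsRootedHardCore δ μ) → Literature.Probability.Process.IsPointStationaryLaw P → (∃ R₇ R₈ R₉ : ℝ, ∀ᵐ μ ∂P, Appr μ R₇ R₈ R₉) → (∀ᵐ μ ∂P, ∀ p : EuclideanSpace ℝ (Fin 3), μ {p} ≠ 0 → ∀ y : EuclideanSpace ℝ (Fin 3), (∀ q : EuclideanSpace ℝ (Fin 3), μ {q} ≠ 0 → q ≠ p → y ≠ q) → ∑' q : {q : EuclideanSpace ℝ (Fin 3) // μ {q} ≠ 0 ∧ q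 ≠ p}, Literature.MathematicalPhysics.StatisticalMechanics.lennardJones (dist p (q : EuclideanSpace ℝ (Fin 3))) ≤ ∑' q : {q : EuclideanSpace ℝ (Fin 3) // μ {q} ≠ 0 ∧ q ≠ p}, Literature.MathematicalPhysics.StatisticalMechanics.lennardJones (dist y (q : EuclideanSpace ℝ (Fin 3)))) → P {μ : MeasureTheory.Measure (EuclideanSpace ℝ (Fin 3)) | ∃ Q : Literature.MathematicalPhysics.StatisticalMechanics.PeriodicConfiguration 3, ∃ t : EuclideanSpace ℝ (Fin 3), {p : EuclideanSpace ℝ (Fin 3) | μ {p} ≠ 0} = (fun s => s + t) '' Q.points} = 0 → (∀ᵐ μ ∂P, ((∀ r : EuclideanSpace ℝ (Fin 3), Summable fun y : ↥((AtomS μ)) => Literature.MathematicalPhysics.StatisticalMechanics.lennardJones (dist r y)) ∧ ∀ (n : ℕ) (xf : Fin n → EuclideanSpace ℝ (Fin 3)), Function.Injective xf → Set.range xf ⊆ (AtomS μ) → ∀ (k : ℕ) (R : Fin k → EuclideanSpace ℝ (Fin 3)), Function.Injective R → Disjoint (Set.range R) ((AtomS μ) \ Set.range xf) → Literature.MathematicalPhysics.StatisticalMechanics.interactionEnergy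 Literature.MathematicalPhysics.StatisticalMechanics.lennardJones xf + (∑ i, ∑' y : ↥((AtomS μ) \ Set.range xf), Literature.MathematicalPhysics.StatisticalMechanics.lennardJones (dist (xf i) y)) - (⨅ Q : Literature.MathematicalPhysics.StatisticalMechanics.PeriodicConfiguration 3, Q.energyPerParticle Literature.MathematicalPhysics.StatisticalMechanics.lennardJones) * n ≤ Literature.MathematicalPhysics.StatisticalMechanics.interactionEnergy Literature.MathematicalPhysics.StatisticalMechanics.lennardJones R + (∑ i, ∑' y : ↥((AtomS μ) \ Set.range xf), Literature.MathematicalPhysics.StatisticalMechanics.lennardJones (dist (R i) y)) - (⨅ Q : Literature.MathematicalPhysics.StatisticalMechanics.PeriodicConfiguration 3, Q.energyPerParticle Literature.MathematicalPhysics.StatisticalMechanics.lennardJones) * k)) → P {μ : MeasureTheory.Measure (EuclideanSpace ℝ (Fin 3)) | ∃ x : EuclideanSpace ℝ (Fin 3), x ∈ AtomS μ ∧ ¬ GyS (1 / 8) (AtomS μ) x ∧ CollarS (AtomS μ) x} ≠ 0 → (∫ μ, Literature.MathematicalPhysics.StatisticalMechanics.rootEnergy Literature.MathematicalPhysics.StatisticalMechanics.lennardJones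 μ ∂P) ≤ (⨅ Q : Literature.MathematicalPhysics.StatisticalMechanics.PeriodicConfiguration 3, Q.energyPerParticle Literature.MathematicalPhysics.StatisticalMechanics.lennardJones) → ∃ S : Set (EuclideanSpace ℝ (Fin 3)), (0 : EuclideanSpace ℝ (Fin 3)) ∈ S ∧ (∀ p ∈ S, ∀ q ∈ S, p ≠ q → δ ≤ dist p q) ∧ (∃ R₇ R₈ R₉ : ℝ, ApprS S R₇ R₈ R₉) ∧ NashS S ∧ (¬ ∃ (Q : Literature.MathematicalPhysics.StatisticalMechanics.PeriodicConfiguration 3) (t : EuclideanSpace ℝ (Fin 3)), S = (fun s => s + t) '' Q.points) ∧ (∃ x : EuclideanSpace ℝ (Fin 3), x ∈ S ∧ ¬ GyS (1 / 8) S x ∧ CollarS S x) ∧ Literature.MathematicalPhysics.StatisticalMechanics.IsMuGSC Literature.MathematicalPhysics.StatisticalMechanics.lennardJones (⨅ Q : Literature.MathematicalPhysics.StatisticalMechanics.PeriodicConfiguration 3, Q.energyPerParticle Literature.MathematicalPhysics.StatisticalMechanics.lennardJones) S := by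
  intro δ hδ P
  dsimp only
  intro hP hcore _hstat happr hnash hper hmu hpos _hle
  haveI := hP
  obtain ⟨R₇, R₈, R₉, happr'⟩ := happr
  have hnp : ∀ᵐ μ ∂P, ¬ (∃ Q : PeriodicConfiguration 3, ∃ t : EuclideanSpace ℝ (Fin 3),
      {p : EuclideanSpace ℝ (Fin 3) | μ {p} ≠ 0} = (fun s => s + t) '' Q.points) := by
    have := measure_eq_zero_iff_ae_notMem.mp hper
    filter_upwards [this] with μ hμ
    simpa only [Set.mem_setOf_eq] using hμ
  have hfr := frequently_ae_mem_iff.mpr hpos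
  obtain ⟨μ, hev, hc, ha, hn, hm, hnper⟩ :=
    (hfr.and_eventually (hcore.and (happr'.and (hnash.and (hmu.and hnp))))).exists
  rw [Set.mem_setOf_eq] at hev
  obtain ⟨S, h0, hsep, rfl⟩ := hc
  have hZ := setOf_count_restrict_ne_zero S
  have hq : ∀ q : EuclideanSpace ℝ (Fin 3),
      (Measure.count : Measure (EuclideanSpace ℝ (Fin 3))).restrict S {q} ≠ 0 ↔ q ∈ S :=
    count_restrict_singleton_ne_zero_iff S
  refine ⟨S, h0, hsep, ⟨R₇, R₈, R₉, ?_⟩, ?_, ?_, ?_, ?_⟩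
  · -- texture approachability, set level
    simp only [hq] at ha
    intro q hqS R ε hε
    obtain ⟨N, y, i, htex, h1, h2⟩ := ha q hqS R ε hε
    exact ⟨N, y, i, htex, fun p hp hpq => h1 p hp hpq, fun k hk => by
      obtain ⟨p, hp, hpk⟩ := h2 k hk; exact ⟨p, hp, hpk⟩⟩
  · -- Nash, set level
    intro p hp y hy
    have key : ∀ f : EuclideanSpace ℝ (Fin 3) → ℝ,
        ∑' q : {q : EuclideanSpace ℝ (Fin 3) //
            (Measure.count : Measure (EuclideanSpace ℝ (Fin 3))).restrict S {q} ≠ 0 ∧ q ≠ p}, f q =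
          ∑' q : {q : EuclideanSpace ℝ (Fin 3) // q ∈ S ∧ q ≠ p}, f q := fun f =>
      Summit.AtomisticToContinuum.Crystallization.Theorems.RepetitiveNetworkReductionRecurrentMember.tsum_subtype_congr_prop (fun x => by rw [hq]) f
    have h1 := hn p ((hq p).2 hp) y (fun q hq' hqp => hy q ((hq q).1 hq') hqp)
    rw [key (fun q => lennardJones (dist p q)), key (fun q => lennardJones (dist y q))] at h1
    exact h1
  · rw [hZ] at hnper; exact hnper
  · rw [hZ] at hev; exact hev
  · rw [hZ] at hm; exact hm

end Summit.AtomisticToContinuum.Crystallization.Theorems.GrainCoreNetworkSplitCoreCharge
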